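import Summits.PneNP.PneNP.Theorems.SymmetryBudgetNoHiddenOrderLexMinSocket

/-!
# `NoHiddenOrder` (stmt-PneNP-14781): the GRAPH-LEVEL socket for a symmetric threshold program with one output gate per entry

Route `PneNP/SymmetryBudget`. The lex-min socket (`…LexMinSocket.lean`) asks a flagged label to carry the RAW relabelled matrix
`x ∘ (ρ × ρ)`; a canonical form of the GRAPH `Gr x` (which is all `NoHiddenOrder` is about, and all a graph canoniser — e.g. the certified-label
scheme over the Corneil–Goldberg process, whose root value is `encOf (Gr x|W) col₀ l` — can supply for a non-symmetric `x`) only determines that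
matrix up to `SimpleGraph.fromRel`. The entry-wise landing pad `noHiddenOrder_of_entrywiseCanoniser` (p142287) needs no more than that. This file is
the corresponding socket at the level of the program calculus, with NO top lex-min layer (the certified scheme has a single root label):

`GraphProgram m`: a program `P`, output gates `out q₀`, symmetry data `θ` over the budget with `IsSym` and the outputs fixed, and GRAPH-LEVEL
soundness — `fromRel (sem x ∘ out) = fromRel (x ∘ (ρ × ρ))` for some `ρ` in the budget. `noHiddenOrder_of_graphProgram`: such programs of size
`2·|Λ| + 2 ≤ q m` for all large `m` give `NoHiddenOrder`. Also `LexMinProgram.toGraphProgram` (the lex-min socket factors through this one).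
Sorry-free; supports stmt-PneNP-14781, does not close it.
-/

set_option linter.dupNamespace false -- `Summit.PneNP.PneNP.…` (D-0017 single-conjunct layout)

namespace Summit.PneNP.PneNP.Theorems

open scoped Classical
open Filter Literature.Computability.Complexity Literature.Computability.Complexity.SymProg
open Summit.PneNP.PneNP.Theses.SymmetryBudget

/-- **What a symmetric threshold program must provide to be a window GRAPH canoniser at size `m`**: one output gate per matrix entry, symmetry
data for the budget `Bud(m,⌊log₂ m⌋)` fixing the outputs, and graph-level soundness: the graph of the output matrix is the graph of a
`Bud`-relabelling of the input. [folklore] -/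
structure GraphProgram (m : ℕ) where
  /-- the logical gates -/
  Λ : Type
  /-- finitely many gates -/
  [instFintype : Fintype Λ]
  /-- with decidable equality -/
  [instDecEq : DecidableEq Λ]
  /-- the program -/
  P : SymProg (Fin m × Fin m) Λ
  /-- the output gate of entry `q₀` -/
  out : Fin m × Fin m → Λ
  /-- symmetry data: the relabelling of gates over each permutation of the budget -/
  θ : Equiv.Perm (Fin m) → Λ ≃ Λ
  /-- … is a symmetry of the program over the diagonal input map -/
  isSym : ∀ ρ ∈ pointStabiliserBudget m (Nat.log 2 m), P.IsSym (SymProg.diagMap ρ) (θ ρ)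
  /-- … fixing the output gates -/
  out_fixed : ∀ ρ ∈ pointStabiliserBudget m (Nat.log 2 m), ∀ q₀, θ ρ (out q₀) = out q₀
  /-- graph-level soundness: the output graph is the graph of a `Bud`-relabelling of the input -/
  sound : ∀ x, ∃ ρ ∈ pointStabiliserBudget m (Nat.log 2 m),
    (SimpleGraph.fromRel fun u v => P.sem x (out (u, v)) = true) = SimpleGraph.fromRel fun u v => x (ρ u, ρ v) = true

namespace GraphProgram

variable {m : ℕ} (D : GraphProgram m)

attribute [instance] GraphProgram.instFintype GraphProgram.instDecEq

/-- The matrix computed by the program. [folklore] -/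
def CF (x : Fin m × Fin m → Bool) (q₀ : Fin m × Fin m) : Bool := D.P.sem x (D.out q₀)

end GraphProgram

/-- **The graph-level socket.** If for one polynomial `q` and all large `m` there is a graph program of size `2·|Λ| + 2 ≤ q m`, then
`NoHiddenOrder` — via the entry-wise landing pad `noHiddenOrder_of_entrywiseCanoniser`. [folklore] -/
theorem noHiddenOrder_of_graphProgram (q : Polynomial ℕ)
    (h : ∀ᶠ m : ℕ in atTop, ∃ D : GraphProgram m, 2 * Fintype.card D.Λ + 2 ≤ q.eval m) : NoHiddenOrder := by
  refine noHiddenOrder_of_entrywiseCanoniser q (h.mono fun m hm => ?_)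
  obtain ⟨D, hsize⟩ := hm
  refine ⟨D.CF, fun q₀ => ?_, fun x => D.sound x⟩
  -- every entry is a `Bud`-symmetric threshold circuit of size `2·|Λ| + 2` (`SymProg.hasSymCircuit_gate`, as in `LexMinProgram.hasSymCircuit_CF`)
  obtain ⟨C, hB, hs, hS, hc⟩ : HasSymCircuit tcBasis (pointStabiliserBudget m (Nat.log 2 m)) (2 * Fintype.card D.Λ + 2) fun x => D.CF x q₀ :=
    D.P.hasSymCircuit_gate _ D.θ D.isSym fun ρ hρ => D.out_fixed ρ hρ _
  exact ⟨C, hB, hs.trans hsize, hS, hc⟩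

namespace LexMinProgram

variable {m : ℕ} (D : LexMinProgram m)

/-- **The lex-min socket factors through the graph socket**: forget the top layer's raw-entry soundness down to the graph. [folklore] -/
def toGraphProgram : GraphProgram m where
  Λ := D.Λ
  P := D.P
  out q₀ := D.G.out (finProdFinEquiv q₀)
  θ := D.θ
  isSym := D.isSym
  out_fixed ρ hρ q₀ := D.out_fixed ρ hρ _
  sound x := by
    obtain ⟨ρ, hρ, hCF⟩ := D.exists_CF_eq x
    refine ⟨ρ, hρ, ?_⟩
    have : (fun q₀ : Fin m × Fin m => D.P.sem x (D.G.out (finProdFinEquiv q₀))) = fun q₀ => x (ρ q₀.1, ρ q₀.2) := funext hCF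
    show (SimpleGraph.fromRel fun u v => (fun q₀ : Fin m × Fin m => D.P.sem x (D.G.out (finProdFinEquiv q₀))) (u, v) = true) = _
    rw [this]

/-- The size is unchanged. [folklore] -/
theorem card_toGraphProgram : Fintype.card D.toGraphProgram.Λ = Fintype.card D.Λ := rfl

end LexMinProgram

end Summit.PneNP.PneNP.Theorems
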